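import Mathlib
import Summits.ValiantsHypothesis.ValiantsHypothesis.Theorems.BinomialElusiveBinomialCandidatePolarNoCommonZero

/-!
# Crux `BinomialElusive.BinomialCandidate` (stmt-ValiantsHypothesis-7392), line `registered` —
# helper for the stub `stub_polarPeeling`: immersive-at-infinity `Γ` admit no polar solution

The registered stub `stub_polarPeeling` (polar half of the sibling crux `PeelingLemma`,
stmt-ValiantsHypothesis-7391) concerns quadratic maps `Γ : ℂ^{m-1} → ℂ^m` together with a formal
LAURENT solution `p` of `Γ(p) = (t^{N a_i} + t^{N b_i})_i` having a genuine pole.  Wave 2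
(`BinomialElusiveBinomialCandidatePolarNoCommonZero`) showed that the pole direction `z ≠ 0` is a
common zero of the quadratic parts `B_i = homogeneousComponent 2 (Γ i)`.  This file lands the
next order of the peeling from the deepest pole, uniform in `m` and Mathlib-only (plus the wave-1/2
helpers `AffinePeeling.algebraMap_laurentSeries_apply`, `PolarPeeling.coeff_mul_eq_zero_of_lt`,
`PolarPeeling.coeff_binomial_eq_zero_of_neg`):

* `PolarImmersive.jet_*` — FIRST-ORDER JETS.  "`x` agrees with `Z + V t^o` up to the exponent
  `o`" is stable under sums and (for `o > 0`) products with the Leibniz rule, hence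
  (`jet_aeval`, induction on the polynomial) `φ(x)` agrees with `φ(Z) + (Σ_j V_j ∂_jφ(Z)) t^o`:
  evaluation at a jet is evaluation at a dual number.
* `PolarImmersive.differential_at_infinity` — THE CHART AT INFINITY.  Write `p j = α q j` with
  `w₀ α = 1`, `w₀ = 0 + c t^o`, `q j = z j + v j t^o` (`o > 0`).  Splitting `Γ = K + L + B` into
  homogeneous pieces (`eq_add_homogeneousComponent`, `aeval_mul_of_isHomogeneous`) gives
  `w₀² Γ(p) = w₀² K + w₀ L(q) + B(q)`, a jet with constant term `B(z)` and `t^o`-coefficient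
  `c L(z) + Σ_j v_j ∂_jB(z)`, while the left side has no coefficients below `2o` as soon as
  `Γ(p)` has none below `0`.  So `B(z) = 0` and `(c, v)` lies in the kernel of the differential
  at infinity `(c, v) ↦ c L(z) + Σ_j v_j ∂_jB(z)`.
* `PolarImmersive.polar_immersive_no_solution` — with `j₁` a coordinate of least order `μ < 0`,
  `w₀ = (p j₁)⁻¹`, `q j = w₀ p j` (so `q j₁ = 1`, `z j₁ = 1`, `z ≠ 0`) and `o` the least positive
  exponent carrying a nonzero coefficient of `w₀` or of some `q j - z j`: if the kernel is the
  minimal one `{0} × ℂ z` ("`Γ` immersive at the point at infinity in direction `z`"), then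
  `c = 0` and `v = μ' z` with `v j₁ = 0`, so `v = 0` — contradicting the choice of `o`.
* `polarPeeling_immersiveAtInfinity` — the registered stub's statement with the extra
  immersivity hypothesis, for every `m ≥ 1` (vacuously: the hypotheses are contradictory).

Source of the line: Garg–Makam–Oliveira–Wigderson 2019 (arXiv:1904.04299) §9 (Lemma 9.3,
Prop. 9.8); the computation is first-order calculus of formal Laurent series, folklore.  NOT here:
`Γ` whose quadratic parts share a zero `z` AND whose differential at infinity in direction `z`
drops rank — the remaining open content of `stub_polarPeeling`.
-/

-- layout Summits/ValiantsHypothesis/ValiantsHypothesis forces the duplicated namespace component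
set_option linter.dupNamespace false

namespace Summit.ValiantsHypothesis.ValiantsHypothesis.Theorems.BinomialCandidateStubs

open scoped BigOperators

namespace PolarImmersive

/-! ## First-order jets of Laurent series

Throughout, "`x` is the jet `Z + V t^o`" is spelled out as
`∀ g ≤ o, x.coeff g = (if g = 0 then Z else 0) + if g = o then V else 0`:
no coefficients at negative exponents, constant coefficient `Z`, nothing strictly between `0`
and `o`, coefficient `V` at `o`. -/

variable {o : ℤ} {x y : LaurentSeries ℂ} {Z V Z₁ V₁ Z₂ V₂ Z' V' : ℂ}

/-- Transport a jet along equalities of its data. -/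
theorem jet_congr (h : ∀ g ≤ o, x.coeff g = (if g = 0 then Z else 0) + if g = o then V else 0)
    (hxy : x = y) (hZ : Z = Z') (hV : V = V') :
    ∀ g ≤ o, y.coeff g = (if g = 0 then Z' else 0) + if g = o then V' else 0 :=
  hxy ▸ hZ ▸ hV ▸ h

/-- The constant coefficient of a jet (for `o > 0`). -/
theorem jet_coeff_zero
    (h : ∀ g ≤ o, x.coeff g = (if g = 0 then Z else 0) + if g = o then V else 0) (ho : 0 < o) :
    x.coeff 0 = Z := by
  rw [h 0 ho.le, if_pos rfl, if_neg ho.ne, add_zero]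

/-- The coefficient of a jet at `o` (for `o > 0`). -/
theorem jet_coeff_self
    (h : ∀ g ≤ o, x.coeff g = (if g = 0 then Z else 0) + if g = o then V else 0) (ho : 0 < o) :
    x.coeff o = V := by
  rw [h o le_rfl, if_neg ho.ne', if_pos rfl, zero_add]

/-- A series with no coefficients below `o` is the jet `0 + (x.coeff o) t^o`. -/
theorem jet_of_coeff_eq_zero (hx : ∀ g < o, x.coeff g = 0) :
    ∀ g ≤ o, x.coeff g = (if g = 0 then (0 : ℂ) else 0) + if g = o then x.coeff o else 0 := by
  intro g hg
  rcases hg.lt_or_eq with hg | rfl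
  · rw [hx g hg, if_neg hg.ne, ite_self, add_zero]
  · rw [ite_self, if_pos rfl, zero_add]

/-- The coefficients of the model series `Z + V t^o`. -/
theorem coeff_C_add_single (o : ℤ) (Z V : ℂ) (g : ℤ) :
    (HahnSeries.C Z + HahnSeries.single o V : LaurentSeries ℂ).coeff g =
      (if g = 0 then Z else 0) + if g = o then V else 0 := by
  rw [HahnSeries.coeff_add, HahnSeries.C_apply, HahnSeries.coeff_single, HahnSeries.coeff_single]
  split_ifs <;> rfl

/-- Constants are jets. -/
theorem jet_C (o : ℤ) (Z : ℂ) : ∀ g ≤ o, (HahnSeries.C Z : LaurentSeries ℂ).coeff g =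
    (if g = 0 then Z else 0) + if g = o then (0 : ℂ) else 0 := by
  intro g _
  rw [HahnSeries.C_apply, HahnSeries.coeff_single, ite_self, add_zero]
  split_ifs <;> rfl

/-- Jets add. -/
theorem jet_add (h₁ : ∀ g ≤ o, x.coeff g = (if g = 0 then Z₁ else 0) + if g = o then V₁ else 0)
    (h₂ : ∀ g ≤ o, y.coeff g = (if g = 0 then Z₂ else 0) + if g = o then V₂ else 0) :
    ∀ g ≤ o, (x + y).coeff g = (if g = 0 then Z₁ + Z₂ else 0) + if g = o then V₁ + V₂ else 0 := by
  intro g hg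
  rw [HahnSeries.coeff_add, h₁ g hg, h₂ g hg]
  split_ifs <;> ring

/-- Jets multiply by the Leibniz rule (for `o > 0`, so that `t^o · t^o` is invisible). -/
theorem jet_mul (ho : 0 < o)
    (h₁ : ∀ g ≤ o, x.coeff g = (if g = 0 then Z₁ else 0) + if g = o then V₁ else 0)
    (h₂ : ∀ g ≤ o, y.coeff g = (if g = 0 then Z₂ else 0) + if g = o then V₂ else 0) :
    ∀ g ≤ o, (x * y).coeff g =
      (if g = 0 then Z₁ * Z₂ else 0) + if g = o then Z₁ * V₂ + V₁ * Z₂ else 0 := by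
  set x' : LaurentSeries ℂ := HahnSeries.C Z₁ + HahnSeries.single o V₁ with hx'def
  set y' : LaurentSeries ℂ := HahnSeries.C Z₂ + HahnSeries.single o V₂ with hy'def
  have hx'' : ∀ g < o + 1, (x - x').coeff g = 0 := fun g hg => by
    rw [HahnSeries.coeff_sub, h₁ g (by omega), hx'def, coeff_C_add_single, sub_self]
  have hy'' : ∀ g < o + 1, (y - y').coeff g = 0 := fun g hg => by
    rw [HahnSeries.coeff_sub, h₂ g (by omega), hy'def, coeff_C_add_single, sub_self]
  have hx' : ∀ g < 0, x'.coeff g = 0 := fun g hg => by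
    rw [hx'def, coeff_C_add_single, if_neg (by omega), if_neg (by omega), add_zero]
  have hy : ∀ g < 0, y.coeff g = 0 := fun g hg => by
    rw [h₂ g (by omega), if_neg (by omega), if_neg (by omega), add_zero]
  have key : x * y = x' * y' + (x' * (y - y') + (x - x') * y) := by ring
  intro g hg
  rw [key, HahnSeries.coeff_add, HahnSeries.coeff_add,
    PolarPeeling.coeff_mul_eq_zero_of_lt hx' hy'' g (by omega),
    PolarPeeling.coeff_mul_eq_zero_of_lt hx'' hy g (by omega), add_zero, add_zero]
  have hg2 : g ≠ o + o := by omega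
  simp only [hx'def, hy'def, mul_add, add_mul, HahnSeries.C_apply, HahnSeries.single_mul_single,
    HahnSeries.coeff_add, HahnSeries.coeff_single, zero_add, add_zero, hg2, if_false]
  split_ifs <;> ring

/-- **Jets of polynomial expressions** (evaluation at a first-order jet, dual-number style):
if each `x j` is the jet `Z j + V j t^o` (`o > 0`), then `φ(x)` is the jet
`φ(Z) + (Σ_j V j ∂_jφ(Z)) t^o`. -/
theorem jet_aeval {k : ℕ} (ho : 0 < o) {x : Fin k → LaurentSeries ℂ} {Z V : Fin k → ℂ}
    (hx : ∀ j, ∀ g ≤ o, (x j).coeff g = (if g = 0 then Z j else 0) + if g = o then V j else 0)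
    (φ : MvPolynomial (Fin k) ℂ) :
    ∀ g ≤ o, (MvPolynomial.aeval x φ).coeff g =
      (if g = 0 then MvPolynomial.eval Z φ else 0) +
        if g = o then ∑ j, V j * MvPolynomial.eval Z (MvPolynomial.pderiv j φ) else 0 := by
  induction φ using MvPolynomial.induction_on with
  | C a =>
    refine jet_congr (jet_C o a) ?_ ?_ ?_
    · rw [MvPolynomial.aeval_C, AffinePeeling.algebraMap_laurentSeries_apply, HahnSeries.C_apply]
    · rw [MvPolynomial.eval_C]
    · simp only [MvPolynomial.pderiv_C, map_zero, mul_zero, Finset.sum_const_zero]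
  | add p q hp hq =>
    refine jet_congr (jet_add hp hq) ?_ ?_ ?_
    · rw [map_add]
    · rw [map_add]
    · simp only [map_add, mul_add, Finset.sum_add_distrib]
  | mul_X p j hp =>
    refine jet_congr (jet_mul ho hp (hx j)) ?_ ?_ ?_
    · rw [map_mul, MvPolynomial.aeval_X]
    · rw [map_mul, MvPolynomial.eval_X]
    · simp only [MvPolynomial.pderiv_mul, map_add, map_mul, MvPolynomial.eval_X, mul_add,
        Finset.sum_add_distrib, Finset.sum_mul]
      rw [add_comm]
      congr 1
      · refine Finset.sum_congr rfl fun l _ => ?_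
        ring
      · rw [Finset.sum_eq_single j]
        · rw [MvPolynomial.pderiv_X_self, map_one]
          ring
        · intro l _ hl
          rw [MvPolynomial.pderiv_X_of_ne (Ne.symm hl), map_zero]
          ring
        · intro h
          exact absurd (Finset.mem_univ j) h

/-! ## Homogeneous pieces under the substitution `p = α • q` -/

/-- Homogeneity: `φ(α q) = α^n φ(q)` for `φ` homogeneous of degree `n`. -/
theorem aeval_mul_of_isHomogeneous {k n : ℕ} (φ : MvPolynomial (Fin k) ℂ)
    (hφ : φ.IsHomogeneous n) (α : LaurentSeries ℂ) (q : Fin k → LaurentSeries ℂ) :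
    MvPolynomial.aeval (fun j => α * q j) φ = α ^ n * MvPolynomial.aeval q φ := by
  conv_lhs => rw [φ.as_sum]
  conv_rhs => rw [φ.as_sum]
  rw [map_sum, map_sum, Finset.mul_sum]
  refine Finset.sum_congr rfl fun d hd => ?_
  rw [MvPolynomial.aeval_monomial, MvPolynomial.aeval_monomial, Finsupp.prod_pow,
    Finsupp.prod_pow]
  simp_rw [mul_pow]
  rw [Finset.prod_mul_distrib, Finset.prod_pow_eq_pow_sum, ← Finsupp.degree_eq_sum,
    Finsupp.degree_apply, ← hφ.degree_eq_sum_deg_support hd]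
  ring

/-- A polynomial of total degree `≤ 2` is the sum of its homogeneous components of degrees
`0, 1, 2`. -/
theorem eq_add_homogeneousComponent {k : ℕ} (Γ : MvPolynomial (Fin k) ℂ)
    (hΓ : Γ.totalDegree ≤ 2) :
    Γ = MvPolynomial.homogeneousComponent 0 Γ + MvPolynomial.homogeneousComponent 1 Γ +
      MvPolynomial.homogeneousComponent 2 Γ := by
  have h3 : ∑ i ∈ Finset.range 3, MvPolynomial.homogeneousComponent i Γ = Γ := by
    rw [← Finset.sum_range_add_sum_Ico _ (show Γ.totalDegree + 1 ≤ 3 by omega),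
      MvPolynomial.sum_homogeneousComponent, Finset.sum_eq_zero, add_zero]
    intro i hi
    rw [Finset.mem_Ico] at hi
    exact MvPolynomial.homogeneousComponent_eq_zero _ _ (by omega)
  conv_lhs => rw [← h3]
  simp only [Finset.sum_range_succ, Finset.sum_range_zero, zero_add]

/-! ## The differential at infinity -/

/-- **Orders in the chart at infinity.**  Let `o > 0`, let `w₀ = 0 + c t^o` and
`q j = z j + v j t^o` be jets with `w₀ α = 1`, and let `Γ` (`totalDegree ≤ 2`, homogeneous pieces
`K + L + B`) have an output `Γ(α q)` without coefficients at negative exponents.  Then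
`w₀² Γ(α q) = w₀² K + w₀ L(q) + B(q)`; the left side has no coefficients below `2o > o`, while the
right side is the jet `B(z) + (c L(z) + Σ_j v_j ∂_jB(z)) t^o`.  Hence `B(z) = 0` and
`c L(z) + Σ_j v_j ∂_jB(z) = 0`. -/
theorem differential_at_infinity {k : ℕ} {o : ℤ} (ho : 0 < o) (w₀ α : LaurentSeries ℂ)
    (hw₀α : w₀ * α = 1) (q : Fin k → LaurentSeries ℂ) (z v : Fin k → ℂ) (c : ℂ)
    (hw₀ : ∀ g ≤ o, w₀.coeff g = (if g = 0 then (0 : ℂ) else 0) + if g = o then c else 0)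
    (hq : ∀ j, ∀ g ≤ o, (q j).coeff g = (if g = 0 then z j else 0) + if g = o then v j else 0)
    (Γ : MvPolynomial (Fin k) ℂ) (hΓ : Γ.totalDegree ≤ 2)
    (hout : ∀ g < 0, (MvPolynomial.aeval (fun j => α * q j) Γ).coeff g = 0) :
    MvPolynomial.eval z (MvPolynomial.homogeneousComponent 2 Γ) = 0 ∧
      c * MvPolynomial.eval z (MvPolynomial.homogeneousComponent 1 Γ) +
        ∑ j, v j * MvPolynomial.eval z
          (MvPolynomial.pderiv j (MvPolynomial.homogeneousComponent 2 Γ)) = 0 := by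
  set K := MvPolynomial.homogeneousComponent 0 Γ
  set L := MvPolynomial.homogeneousComponent 1 Γ
  set B := MvPolynomial.homogeneousComponent 2 Γ
  -- the identity `w₀² Γ(α q) = w₀² K(q) + w₀ L(q) + B(q)`
  have e : ∀ n, MvPolynomial.aeval (fun j => α * q j) (MvPolynomial.homogeneousComponent n Γ) =
      α ^ n * MvPolynomial.aeval q (MvPolynomial.homogeneousComponent n Γ) := fun n =>
    aeval_mul_of_isHomogeneous _ (MvPolynomial.homogeneousComponent_isHomogeneous n Γ) α q
  have hT : w₀ * w₀ * MvPolynomial.aeval (fun j => α * q j) Γ =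
      w₀ * w₀ * MvPolynomial.aeval q K + w₀ * MvPolynomial.aeval q L +
        MvPolynomial.aeval q B := by
    conv_lhs => rw [eq_add_homogeneousComponent Γ hΓ, map_add, map_add, e 0, e 1, e 2]
    linear_combination
      (w₀ * MvPolynomial.aeval q L + (w₀ * α + 1) * MvPolynomial.aeval q B) * hw₀α
  -- the left side has no coefficients below `2o`
  have hw₀van : ∀ g < o, w₀.coeff g = 0 := fun g hg => by
    rw [hw₀ g hg.le, if_neg hg.ne, ite_self, add_zero]
  have hLHS : ∀ g < o + o, (w₀ * w₀ * MvPolynomial.aeval (fun j => α * q j) Γ).coeff g = 0 :=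
    fun g hg => PolarPeeling.coeff_mul_eq_zero_of_lt
      (PolarPeeling.coeff_mul_eq_zero_of_lt hw₀van hw₀van) hout g (by omega)
  -- the right side is a jet
  have hRHS := jet_add (jet_add (jet_mul ho (jet_mul ho hw₀ hw₀) (jet_aeval ho hq K))
    (jet_mul ho hw₀ (jet_aeval ho hq L))) (jet_aeval ho hq B)
  have h0 := jet_coeff_zero hRHS ho
  have h1 := jet_coeff_self hRHS ho
  rw [← hT, hLHS 0 (by omega)] at h0
  rw [← hT, hLHS o (by omega)] at h1
  constructor
  · linear_combination -h0
  · linear_combination -h1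

/-- **Immersive-at-infinity `Γ` admit no polar solution.**  If some `p j` has a pole, every
output `Γ_i(p)` (`totalDegree ≤ 2`) has no coefficients at negative exponents, and for every
nonzero common zero `z` of the quadratic parts `B_i` the differential at infinity
`(c, v) ↦ (c L_i(z) + Σ_j v_j ∂_jB_i(z))_i` has the minimal kernel `{0} × ℂ z`, we reach a
contradiction.  With `j₁` a coordinate of least order `μ < 0`, pass to the chart at infinity
`w₀ = (p j₁)⁻¹` (order `-μ > 0`), `q j = w₀ p j` (no pole; `q j₁ = 1`), `z j = (q j)(0)`,
`w j = q j - z j`; let `o > 0` be the least exponent carrying a nonzero coefficient of `w₀` or of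
some `w j`, and `(c, v)` these coefficients.  `differential_at_infinity` puts `(c, v)` in the
kernel, so `c = 0` and `v = μ' z`; but `v j₁ = 0 ≠ 1 = z j₁` forces `μ' = 0`, i.e. all the
coefficients at `o` vanish — contradicting the choice of `o`. -/
theorem polar_immersive_no_solution {m k : ℕ} (Γ : Fin m → MvPolynomial (Fin k) ℂ)
    (hΓ : ∀ i, (Γ i).totalDegree ≤ 2) (p : Fin k → LaurentSeries ℂ)
    (hpole : ∃ j, (p j).order < 0)
    (himm : ∀ z : Fin k → ℂ, z ≠ 0 →
      (∀ i, MvPolynomial.eval z (MvPolynomial.homogeneousComponent 2 (Γ i)) = 0) →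
      ∀ (c : ℂ) (v : Fin k → ℂ),
        (∀ i, c * MvPolynomial.eval z (MvPolynomial.homogeneousComponent 1 (Γ i)) +
            ∑ j, v j * MvPolynomial.eval z
              (MvPolynomial.pderiv j (MvPolynomial.homogeneousComponent 2 (Γ i))) = 0) →
        c = 0 ∧ ∃ μ : ℂ, v = μ • z)
    (hout : ∀ i, ∀ g < 0, (MvPolynomial.aeval p (Γ i)).coeff g = 0) : False := by
  classical
  -- the deepest pole `μ = ord (p j₁) < 0`
  obtain ⟨j₀, hj₀⟩ := hpole
  obtain ⟨j₁, -, hj₁⟩ :=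
    Finset.exists_min_image Finset.univ (fun j => (p j).order) ⟨j₀, Finset.mem_univ _⟩
  have hμ : (p j₁).order < 0 := lt_of_le_of_lt (hj₁ j₀ (Finset.mem_univ _)) hj₀
  have hp : ∀ j, ∀ g < (p j₁).order, (p j).coeff g = 0 := fun j g hg =>
    HahnSeries.coeff_eq_zero_of_lt_order (lt_of_lt_of_le hg (hj₁ j (Finset.mem_univ _)))
  have hp₁ : p j₁ ≠ 0 := fun h => by simp [h] at hμ
  -- the chart at infinity: `w₀ = (p j₁)⁻¹`, `q j = w₀ * p j`
  have hw₀α : (p j₁)⁻¹ * p j₁ = 1 := inv_mul_cancel₀ hp₁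
  have hw₀ne : (p j₁)⁻¹ ≠ 0 := inv_ne_zero hp₁
  have hw₀ord : (p j₁)⁻¹.order = -(p j₁).order := by
    have h := HahnSeries.order_mul hw₀ne hp₁
    rw [hw₀α, HahnSeries.order_one] at h
    linarith
  have hw₀van : ∀ g < -(p j₁).order, (p j₁)⁻¹.coeff g = 0 := fun g hg =>
    HahnSeries.coeff_eq_zero_of_lt_order (by rwa [hw₀ord])
  have hw₀lead : (p j₁)⁻¹.coeff (-(p j₁).order) ≠ 0 := by
    rw [← hw₀ord]
    exact HahnSeries.coeff_order_eq_zero.not.mpr hw₀ne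
  set w₀ : LaurentSeries ℂ := (p j₁)⁻¹ with hw₀def
  set q : Fin k → LaurentSeries ℂ := fun j => w₀ * p j with hqdef
  have hpq : p = fun j => p j₁ * q j := by
    funext j
    rw [hqdef, ← mul_assoc, mul_inv_cancel₀ hp₁, one_mul]
  have hq₁ : q j₁ = 1 := hw₀α
  have hqvan : ∀ j, ∀ g < 0, (q j).coeff g = 0 := fun j g hg =>
    PolarPeeling.coeff_mul_eq_zero_of_lt hw₀van (hp j) g (by omega)
  -- the finite point `z` of the chart and the local coordinates `w j = q j - z j`
  set z : Fin k → ℂ := fun j => (q j).coeff 0 with hzdef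
  have hz₁ : z j₁ = 1 := by
    show (q j₁).coeff 0 = 1
    rw [hq₁, HahnSeries.coeff_one, if_pos rfl]
  have hz : z ≠ 0 := fun h => by simp [h] at hz₁
  set w : Fin k → LaurentSeries ℂ := fun j => q j - HahnSeries.C (z j) with hwdef
  have hwvan : ∀ j, ∀ g < 1, (w j).coeff g = 0 := by
    intro j g hg
    simp only [hwdef, HahnSeries.coeff_sub, HahnSeries.C_apply, HahnSeries.coeff_single]
    rcases lt_or_eq_of_le (show g ≤ 0 by omega) with hg | rfl
    · rw [hqvan j g hg, if_neg hg.ne, sub_zero]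
    · rw [if_pos rfl, hzdef, sub_self]
  have hw₁ : w j₁ = 0 := by
    rw [hwdef]
    simp only [hq₁, hz₁, map_one, sub_self]
  -- the least exponent `o ≥ 1` carrying a nonzero coefficient of `w₀` or of some `w j`
  obtain ⟨o, hoP, homin⟩ := Int.exists_least_of_bdd
    (P := fun g => w₀.coeff g ≠ 0 ∨ ∃ j, (w j).coeff g ≠ 0)
    ⟨1, fun g hg => by
      by_contra h
      rcases hg with h0 | ⟨j, hj⟩
      · exact h0 (hw₀van g (by omega))
      · exact hj (hwvan j g (by omega))⟩
    ⟨-(p j₁).order, Or.inl hw₀lead⟩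
  have ho : 0 < o := by
    by_contra h
    rcases hoP with h0 | ⟨j, hj⟩
    · exact h0 (hw₀van o (by omega))
    · exact hj (hwvan j o (by omega))
  have hbelow₀ : ∀ g < o, w₀.coeff g = 0 := fun g hg => by
    by_contra h
    exact absurd (homin g (Or.inl h)) (not_le.mpr hg)
  have hbelow : ∀ j, ∀ g < o, (w j).coeff g = 0 := fun j g hg => by
    by_contra h
    exact absurd (homin g (Or.inr ⟨j, h⟩)) (not_le.mpr hg)
  -- the jets `w₀ = 0 + c t^o`, `q j = z j + v j t^o`
  have hjw₀ := jet_of_coeff_eq_zero hbelow₀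
  have hjq : ∀ j, ∀ g ≤ o, (q j).coeff g =
      (if g = 0 then z j else 0) + if g = o then (w j).coeff o else 0 := fun j => by
    refine jet_congr (jet_add (jet_C o (z j)) (jet_of_coeff_eq_zero (hbelow j))) ?_
      (add_zero _) (zero_add _)
    rw [hwdef]
    ring
  -- the differential at infinity kills `(c, v)`
  have hout' : ∀ i, ∀ g < 0, (MvPolynomial.aeval (fun j => p j₁ * q j) (Γ i)).coeff g = 0 := by
    rw [← hpq]
    exact hout
  have hdiff := fun i => differential_at_infinity ho w₀ (p j₁) hw₀α q z (fun j => (w j).coeff o)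
    (w₀.coeff o) hjw₀ hjq (Γ i) (hΓ i) (hout' i)
  obtain ⟨hc, μ', hv⟩ := himm z hz (fun i => (hdiff i).1) (w₀.coeff o) (fun j => (w j).coeff o)
    fun i => (hdiff i).2
  have hμ' : μ' = 0 := by
    have h := congr_fun hv j₁
    rw [Pi.smul_apply, smul_eq_mul, hz₁, mul_one, hw₁] at h
    rw [← h]
    exact HahnSeries.coeff_zero
  rcases hoP with h0 | ⟨j, hj⟩
  · exact h0 hc
  · refine hj ?_
    have h := congr_fun hv j
    rwa [Pi.smul_apply, smul_eq_mul, hμ', zero_mul] at h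

end PolarImmersive

/-- **`stub_polarPeeling`, immersive-at-infinity corner** (every `m ≥ 1`): the registered stub's
statement with the extra hypothesis that at every nonzero common zero `z ∈ ℂ^{m-1}` of the
quadratic parts `B_i = homogeneousComponent 2 (Γ i)`, the differential at the point at infinity
in direction `z`, `(c, v) ↦ (c L_i(z) + Σ_j v_j ∂_jB_i(z))_i` (`L_i = homogeneousComponent 1`),
has the minimal kernel `{0} × ℂ z`.  It holds vacuously: a polar solution forces a common zero
`z` (the pole direction) AND a kernel vector outside `{0} × ℂ z`
(`PolarImmersive.polar_immersive_no_solution`), the outputs `t^{N a_i} + t^{N b_i}` having no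
coefficients at negative exponents. -/
theorem polarPeeling_immersiveAtInfinity :
    ∀ m ≥ 1, ∀ (a b : Fin m → ℕ) (Γ : Fin m → MvPolynomial (Fin (m - 1)) ℂ) (N : ℕ)
      (p : Fin (m - 1) → LaurentSeries ℂ), (∀ i, (Γ i).totalDegree ≤ 2) → 0 < N →
      (∃ j, (p j).order < 0) →
      (∀ z : Fin (m - 1) → ℂ, z ≠ 0 →
        (∀ i, MvPolynomial.eval z (MvPolynomial.homogeneousComponent 2 (Γ i)) = 0) →
        ∀ (c : ℂ) (v : Fin (m - 1) → ℂ),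
          (∀ i, c * MvPolynomial.eval z (MvPolynomial.homogeneousComponent 1 (Γ i)) +
              ∑ j, v j * MvPolynomial.eval z (MvPolynomial.pderiv j (MvPolynomial.homogeneousComponent 2 (Γ i))) = 0) →
          c = 0 ∧ ∃ μ : ℂ, v = μ • z) →
      (∀ i, MvPolynomial.aeval p (Γ i) =
        HahnSeries.single ((N * a i : ℕ) : ℤ) (1 : ℂ) + HahnSeries.single ((N * b i : ℕ) : ℤ) (1 : ℂ)) →
      ∃ u v : Fin m → ℤ, (u, v) ≠ 0 ∧ ∑ i, (|u i| + |v i|) ≤ ((Nat.log 2 m ^ 2 : ℕ) : ℤ) ∧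
        ∑ i, (u i * (a i : ℤ) + v i * (b i : ℤ)) = 0 := by
  intro m _ a b Γ N p hΓ _ hpole himm hp
  refine (PolarImmersive.polar_immersive_no_solution Γ hΓ p hpole himm fun i g hg => ?_).elim
  rw [hp i]
  exact PolarPeeling.coeff_binomial_eq_zero_of_neg N (a i) (b i) g hg

end Summit.ValiantsHypothesis.ValiantsHypothesis.Theorems.BinomialCandidateStubs
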